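import Literature.NumberTheory.Automorphic.ReciprocityGLnCor93Proofs
import Literature.NumberTheory.Automorphic.ChebotarevArtinRepHolds
import HarnessLib

/-!
# Harris–Lan–Taylor–Thorne 2016, Thm. A — the uniqueness clause, discharged

Topic `Literature/NumberTheory/Automorphic`; namespace
`Literature.NumberTheory.Automorphic.HarrisLanTaylorThorne2016`.  Sibling *proofs* leaf of
`ReciprocityGLnProofs.lean`, whose named fact

* `Literature.NumberTheory.Automorphic.HarrisLanTaylorThorne2016.theoremA_uniqueness`

(M. Harris, K.-W. Lan, R. Taylor, J. Thorne, *On the rigid cohomology of certain Shimura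
varieties*, Res. Math. Sci. 3 (2016), Thm. A, p. 3: "Then there is a **unique** continuous
semi-simple representation `r_{p,ı}(π) : G_E → GL_n(ℚ̄_p)` such that, if `q ≠ p` is a rational
prime above which `π` is unramified and if `v | q` is a prime of `E`, then `r_{p,ı}(π)` is
unramified at `v` and `r_{p,ı}(π)|^{ss}_{W_{E_v}} = ı⁻¹ rec_{E_v}(π_v |det|_v^{(1-n)/2})`") is
DISCHARGED here:

* `HarrisLanTaylorThorne2016.theoremA_uniqueness_holds : theoremA_uniqueness`.

Everything in this file is PROVED (theorems only; no new definition, no named fact, no `sorry`).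
Nothing new is proved either: the file composes results already in the tree.  The source asserts
uniqueness without proof; the classical argument (Chebotarev's density theorem and the
Brauer–Nesbitt theorem: a continuous semisimple representation of a compact group over a field of
characteristic zero is determined by its characteristic polynomials on a dense set, and the
arithmetic Frobenii at the places over the cofinitely many admissible rational primes are dense)
is carried out in the tree as follows.

1. `HarrisLanTaylorThorne2016.theoremA_uniqueness_of` (`ReciprocityGLnUniquenessProofs`):
   uniqueness from Chebotarev in the form `chebotarev_artinRep` and from "automorphic
   representations are unramified almost everywhere" (`hasSatakeParamAt_cofinite`), through the
   density of Frobenius elements (`GaloisRepresentations/FrobeniusDensity`) and Brauer–Nesbitt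
   for `ℓ`-adic representations (`GaloisRepresentations/LAdicRepFrobenius`,
   `FramedGaloisRep.nonempty_equiv_of_hasFrobCharpolyAt_eventually`);
2. `HarrisLanTaylorThorne2016.theoremA_uniqueness_of_chebotarev` (`ReciprocityGLnLeavesProofs`):
   the second hypothesis discharged by Flath's theorem
   (`AutomorphicRepData.hasSatakeParamAt_cofinite_holds`);
3. `chebotarev_artinRep_holds` (`ChebotarevArtinRepHolds`): Chebotarev's density theorem
   (existence form, for the finite extension cut out by an Artin representation), proved in the
   tree from the cyclotomic case (Dirichlet's argument with Weber's ideal count and the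
   regularity of non-principal ray class `L`-series at `s = 1`,
   `GaloisRepresentations/ChebotarevCyclotomicProofs`) by Chebotarev's crossing device and
   Deuring's reduction (`GaloisRepresentations/ChebotarevCyclicProofs`, `ChebotarevFromCyclic`,
   `Automorphic/ChebotarevArtinRepProofs`).

With the Chebotarev hypothesis gone, the two conditional results of the cluster that carried it
only for uniqueness are restated closed: the uniqueness up to isomorphism of the representation
of **lang.S27** (`nonempty_continuousRepEquiv_of_forall_isGaloisCompatibleAt`, from
`nonempty_equiv_of_forall_isGaloisCompatibleAt`) and Varma's Cor. 9.3 (unramified places) from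
lang.S27 alone (`Varma2024.corollary93_unramified_of_regularAlgebraic`,
`Varma2024.corollary93_unramified_iff_regularAlgebraic`, from `ReciprocityGLnCor93Proofs`).

## References

* M. Harris, K.-W. Lan, R. Taylor, J. Thorne, *On the rigid cohomology of certain Shimura
  varieties*, Res. Math. Sci. 3 (2016), Paper No. 37, Thm. A (p. 3).
  doi:10.1186/s40687-016-0078-5 [HarrisLanTaylorThorneRMS2016]
* I. Varma, *Local-global compatibility for regular algebraic cuspidal automorphic
  representations when `ℓ ≠ p`*, Forum Math. Sigma 12 (2024) e21, Cor. 9.3. [VarmaFMS2024]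
* J. Tate, *Global class field theory*, in Cassels–Fröhlich (eds.), *Algebraic Number Theory*
  (1967), Ch. VII §2.4 (Tchebotarev density theorem). [TateGCFT1967]
* P. Deligne, J.-P. Serre, *Formes modulaires de poids 1*, Ann. Sci. ÉNS 7 (1974), Lemme 3.2
  (Brauer–Nesbitt in this use).

## Design notes

* Kept in its own leaf (not appended to `ReciprocityGLnProofs.lean`): the discharge chain imports
  `ReciprocityGLnLeavesProofs → ReciprocityGLnUniquenessProofs → ReciprocityGLnProofs`, so an
  in-place append would close an import cycle; importers wanting the closed theorem import this
  module.
* Axioms of `theoremA_uniqueness_holds`: `propext`, `Classical.choice`, `Quot.sound`.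
-/

open scoped NumberField
open NumberField IsDedekindDomain

namespace Literature.NumberTheory.Automorphic

namespace HarrisLanTaylorThorne2016

/-- **Harris–Lan–Taylor–Thorne 2016, Thm. A — uniqueness, PROVED.**  Let `K` be a totally real
or CM number field, `π` a cuspidal automorphic representation of `GL_n(𝔸_K)` with `π_∞` regular
algebraic, `ℓ` a prime and `ι : ℚ̄_ℓ ≃+* ℂ`.  Two continuous semisimple
`r, r' : Γ_K → GL_n(ℚ̄_ℓ)` with the characterising property of Thm. A (`IsCompatible π ι ·`:
unramified, with the prescribed characteristic polynomial of Frobenius, at every place over a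
rational prime `q ≠ ℓ` above which `π` is unramified) have isomorphic underlying continuous
representations on `ℚ̄_ℓⁿ` ("there is a *unique* continuous semi-simple representation
`r_{p,ı}(π)` such that …").  Discharge of the named fact `theoremA_uniqueness`:
`theoremA_uniqueness_of_chebotarev` (Frobenius density, Brauer–Nesbitt, Flath) applied to the
proved Chebotarev density theorem `chebotarev_artinRep_holds`.
[cite: HarrisLanTaylorThorneRMS2016, Thm. A (p. 3), uniqueness clause] -/
theorem theoremA_uniqueness_holds : theoremA_uniqueness :=
  theoremA_uniqueness_of_chebotarev chebotarev_artinRep_holds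

end HarrisLanTaylorThorne2016

/-- **The representation of lang.S27 is unique up to isomorphism — unconditionally.**  Let `K`
be totally real or CM, `π` a regular algebraic cuspidal automorphic representation of
`GL_n(𝔸_K)`, `ℓ` a prime, `ι : ℚ̄_ℓ ≃+* ℂ`.  If `r, r' : Γ_K → GL_n(ℚ̄_ℓ)` are continuous
semisimple and both are compatible with `π` at every finite `v ∤ ℓ` (`IsGaloisCompatibleAt`),
then their underlying continuous representations are isomorphic:
`nonempty_equiv_of_forall_isGaloisCompatibleAt` (`ReciprocityGLnLeavesProofs`) with its
Chebotarev hypothesis discharged by `chebotarev_artinRep_holds`.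
[cite: HarrisLanTaylorThorneRMS2016, Thm. A (p. 3), uniqueness clause] -/
theorem nonempty_continuousRepEquiv_of_forall_isGaloisCompatibleAt
    {n : ℕ} {K : Type} [Field K] [NumberField K] (hcpt : isCompact_glFiniteIntegralLevel n K)
    (hK : IsTotallyReal K ∨ IsCMField K)
    (π : CuspidalAutomorphicRepData n K hcpt) (hπ : π.1.IsRegularAlgebraic) (ℓ : ℕ) [Fact ℓ.Prime]
    (ι : PadicAlgCl ℓ ≃+* ℂ) (r r' : GaloisRepresentations.FramedGaloisRep K (PadicAlgCl ℓ) n)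
    (hr : r.toGaloisRep.IsSemisimple) (hr' : r'.toGaloisRep.IsSemisimple)
    (hc : ∀ v : HeightOneSpectrum (𝓞 K), ((ℓ : ℕ) : 𝓞 K) ∉ v.asIdeal →
      IsGaloisCompatibleAt π.1 ι r v)
    (hc' : ∀ v : HeightOneSpectrum (𝓞 K), ((ℓ : ℕ) : 𝓞 K) ∉ v.asIdeal →
      IsGaloisCompatibleAt π.1 ι r' v) :
    Nonempty (GaloisRepresentations.ContinuousRep.Equiv r.toGaloisRep r'.toGaloisRep) :=
  nonempty_equiv_of_forall_isGaloisCompatibleAt chebotarev_artinRep_holds hcpt hK π hπ ℓ ι r r' hr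
    hr' hc hc'

namespace Varma2024

/-- **Varma 2024, Cor. 9.3 (unramified places) from lang.S27 alone**:
`corollary93_unramified_of` (`ReciprocityGLnCor93Proofs`) with the uniqueness clause of
Harris–Lan–Taylor–Thorne's Thm. A discharged (`HarrisLanTaylorThorne2016.theoremA_uniqueness_holds`).
[cite: VarmaFMS2024, Cor. 9.3 (p. 32) (= arXiv:1411.2520v1, Cor. 10.3, p. 24)] -/
theorem corollary93_unramified_of_regularAlgebraic (hS : exists_galoisRep_of_regularAlgebraic) :
    corollary93_unramified :=
  corollary93_unramified_of HarrisLanTaylorThorne2016.theoremA_uniqueness_holds hS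

/-- **Varma's Cor. 9.3 (unramified-place form) is equivalent to lang.S27, granted only the
existence half of Harris–Lan–Taylor–Thorne's Thm. A**: `corollary93_unramified_iff` with its
Chebotarev hypothesis discharged by `chebotarev_artinRep_holds`.
[cite: VarmaFMS2024, Thm. 1 (p. 2) and Cor. 9.3 (p. 32)]
[cite: HarrisLanTaylorThorneRMS2016, Thm. A (p. 3)] -/
theorem corollary93_unramified_iff_regularAlgebraic
    (hA : HarrisLanTaylorThorne2016.theoremA_existence) :
    corollary93_unramified ↔ exists_galoisRep_of_regularAlgebraic :=
  corollary93_unramified_iff chebotarev_artinRep_holds hA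

end Varma2024

end Literature.NumberTheory.Automorphic
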